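import Mathlib
import Summits.Ventures.PercRepro2.A3CutExpand

/-!
# The `o`-masses across a cut vertex when the mark `o` lies on the part's side
(blind cell PercRepro2, night-1 g32; proofs/NIGHT1-G32.md §6; the sums and the closure are A3CutFMoTerms.lean
and A3CutFMo.lean)

Setting of A3CutExpand but with `o ∈ VA` (the side of `v`) and `a₁, a₂, b ∈ VB ∪ {x}`.  On every fibre
`W` of the `x`-exploration `o ∈ U` forces `o ∈ W` (a connection from `o` to a root crosses `x`,
`conn_oA_of_conn`), so `Ssig_o = [o ∈ W] · s3 · m_W`, `Su_o = [o ∈ W] · (s3)² · m_W` (`Ssig_o_x_eq`,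
`Su_o_x_eq`) and the first-order form `F = σ_o + σ₃(γ − U_o)` is `σ₃ · γ` whatever the `A`-part
(`SFg0_x_eq`).  On the fibres of `v`: on `{v ↔ x}` the same (`SsigZ_o_eq`, `SuZ_o_eq`), off it the
`o`-masses are `P_A(C_A(v) = W, o ↔ x)` times the `B`-side masses `P(Q, x ↔ a_i)` (`Ssig_o_v_eq`,
`Su_o_v_eq`; `connEvent_o_eq`: `{r ↔ o} = {o ↔_A x} ∩ {x ↔_B r}`).  Standard axioms.
-/

namespace Summit.Ventures.PercRepro2

open UnionCluster CovForm CutV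

namespace CovForm

namespace A3Fibre

section OSide

variable {V : Type*} {E : Type*} [Fintype V] [DecidableEq V] [Fintype E] [DecidableEq E]
  {R : Type*} [Field R] [LinearOrder R] [IsStrictOrderedRing R] {ends : E → Sym2 V} {x : V}
  {VA VB : Finset V} {EA EB : Set E} [DecidablePred (· ∈ EA)] [DecidablePred (· ∈ EB)] {p : E → R}
  {o a₁ a₂ b v : V}

omit [Fintype V] [Fintype E] [DecidableEq E] [Field R] [LinearOrder R]
  [IsStrictOrderedRing R] [DecidablePred (· ∈ EB)] in
/-- A connection from `o ∈ VA` to a vertex of `VB ∪ {x}` passes through `x` inside `A`. -/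
lemma conn_oA_of_conn (h : IsCut ends x ↑VA ↑VB EA EB) (ho : o ∈ VA) {r : V} (hr : r ∈ insert x VB)
    {ω : Config E} (hc : Conn ends ω r o) : Conn ends (restrict EA ω) o x := by
  rcases Finset.mem_insert.1 hr with rfl | hr
  · exact (conn_iff_restrict h (Or.inl (Finset.mem_coe.2 ho)) (Or.inr rfl)).mp (conn_symm hc)
  · have key := conn_collapse h (conn_symm hc)
    rwa [collapse_of_mem (S := ↑VA ∪ {x}) (Or.inl (Finset.mem_coe.2 ho)),
      h.collapse_eq_of_mem_B (Or.inl (Finset.mem_coe.2 hr))] at key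

omit [Fintype V] [Fintype E] [DecidableEq E] [Field R] [LinearOrder R] [IsStrictOrderedRing R]
  [DecidablePred (· ∈ EB)] in
/-- On a fibre of `x` not containing `o`, `o` is in neither root cluster. -/
lemma fibre_x_inter_conn_o_eq_empty (h : IsCut ends x ↑VA ↑VB EA EB) (ho : o ∈ VA) {r : V}
    (hr : r ∈ insert x VB) (a₁ a₂ : V) {W : Finset V} (hoW : o ∉ W) :
    fibre ends a₁ a₂ x W ∩ connEvent ends r o = ∅ := by
  ext ω
  simp only [fibre, Set.mem_inter_iff, mem_clusterEvent, mem_connEvent, Set.mem_empty_iff_false,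
    iff_false, not_and]
  rintro ⟨_, hc⟩ hro
  apply hoW
  have hox := conn_oA_of_conn h ho hr hro
  have : o ∈ cluster ends ω x := conn_symm (conn_mono (restrict_le EA ω) hox)
  rw [hc] at this
  exact Finset.mem_coe.1 this

omit [Fintype V] [LinearOrder R] [IsStrictOrderedRing R] [DecidablePred (· ∈ EB)] in
/-- The `σ_o`-mass on the fibres of `x` when `o` is on the `A`-side. -/
lemma Ssig_o_x_eq (h : IsCut ends x ↑VA ↑VB EA EB) (ho : o ∈ VA) (h1 : a₁ ∈ insert x VB)
    (h2 : a₂ ∈ insert x VB) (W : Finset V) :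
    Ssig p ends a₁ a₂ x o W = (if o ∈ W then 1 else 0) * (s3 a₁ a₂ W * mW p ends a₁ a₂ x W) := by
  by_cases hoW : o ∈ W
  · rw [if_pos hoW, one_mul, Ssig_eq_of_mem p ends a₁ a₂ x o W hoW]
  · rw [if_neg hoW, zero_mul]
    unfold Ssig
    rw [fibre_x_inter_conn_o_eq_empty h ho h1 a₁ a₂ hoW, fibre_x_inter_conn_o_eq_empty h ho h2 a₁ a₂ hoW,
      prob_empty, sub_zero]

omit [Fintype V] [LinearOrder R] [IsStrictOrderedRing R] [DecidablePred (· ∈ EB)] in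
/-- The `U_o`-mass on the fibres of `x` when `o` is on the `A`-side. -/
lemma Su_o_x_eq (h : IsCut ends x ↑VA ↑VB EA EB) (ho : o ∈ VA) (h1 : a₁ ∈ insert x VB)
    (h2 : a₂ ∈ insert x VB) (W : Finset V) :
    Su p ends a₁ a₂ x o W = (if o ∈ W then 1 else 0) * (s3 a₁ a₂ W ^ 2 * mW p ends a₁ a₂ x W) := by
  by_cases hoW : o ∈ W
  · rw [if_pos hoW, one_mul, Su_eq_of_mem p ends a₁ a₂ x o W hoW]
  · rw [if_neg hoW, zero_mul]
    unfold Su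
    rw [fibre_x_inter_conn_o_eq_empty h ho h1 a₁ a₂ hoW, fibre_x_inter_conn_o_eq_empty h ho h2 a₁ a₂ hoW,
      prob_empty, add_zero]

omit [Fintype V] [LinearOrder R] [IsStrictOrderedRing R] [DecidablePred (· ∈ EB)] in
/-- **The first-order form `F⁰` on the fibres of `x` is `σ₃ · γ₀` whatever the `A`-part.** -/
lemma SFg0_x_eq (h : IsCut ends x ↑VA ↑VB EA EB) (ho : o ∈ VA) (h1 : a₁ ∈ insert x VB)
    (h2 : a₂ ∈ insert x VB) (γ : R) (W : Finset V) :
    RootEdge.SFg p ends o a₁ a₂ x γ W = s3 a₁ a₂ W * (γ * mW p ends a₁ a₂ x W) := by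
  unfold RootEdge.SFg
  rw [Ssig_o_x_eq h ho h1 h2, Su_o_x_eq h ho h1 h2]
  unfold s3
  split_ifs <;> ring

end OSide

/-! ## The `o`-masses of the fibres of `v` -/

section OSideV

variable {V : Type*} {E : Type*} [Fintype V] [DecidableEq V] [Fintype E] [DecidableEq E]
  {R : Type*} [Field R] [LinearOrder R] [IsStrictOrderedRing R] {ends : E → Sym2 V} {x : V}
  {VA VB : Finset V} {EA EB : Set E} [DecidablePred (· ∈ EA)] [DecidablePred (· ∈ EB)] {p : E → R}
  {o a₁ a₂ b v : V}

omit [Fintype V] [Fintype E] [DecidableEq E] [Field R] [LinearOrder R] [IsStrictOrderedRing R] in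
/-- `{r ↔ o}` for `o ∈ VA` and `r ∈ VB ∪ {x}` is `{o ↔_A x} ∩ {x ↔_B r}`. -/
lemma connEvent_o_eq (h : IsCut ends x ↑VA ↑VB EA EB) (ho : o ∈ VA) {r : V} (hr : r ∈ insert x VB) :
    connEvent ends r o = sideEvent EA (connEvent ends o x) ∩ sideEvent EB (connEvent ends x r) := by
  ext ω
  simp only [Set.mem_inter_iff, mem_sideEvent, mem_connEvent]
  rcases Finset.mem_insert.1 hr with rfl | hr
  · constructor
    · intro hc
      exact ⟨(conn_iff_restrict h (Or.inl (Finset.mem_coe.2 ho)) (Or.inr rfl)).mp (conn_symm hc),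
        conn_refl _ _ _⟩
    · rintro ⟨hc, _⟩
      exact conn_symm (conn_mono (restrict_le EA ω) hc)
  · constructor
    · intro hc
      exact (conn_across_iff h (Finset.mem_coe.2 ho) (Finset.mem_coe.2 hr)).mp (conn_symm hc)
    · intro hc
      exact conn_symm ((conn_across_iff h (Finset.mem_coe.2 ho) (Finset.mem_coe.2 hr)).mpr hc)

omit [Fintype V] [LinearOrder R] [IsStrictOrderedRing R] in
/-- The `v`-fibre–`{r ↔ o}` mass: the `Z`-restricted `x`-mass plus, off `x`, the `A`-side mass
`P_A(C_A(v) = W, o ↔ x)` times the `B`-side mass `P(Q, x ↔ r)`. -/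
lemma prob_fibre_v_conn_o_eq (h : IsCut ends x ↑VA ↑VB EA EB) (ho : o ∈ VA) (hv : v ∈ VA)
    (h1 : a₁ ∈ insert x VB) (h2 : a₂ ∈ insert x VB) {r : V} (hr : r ∈ insert x VB) (W : Finset V) :
    prob p (fibre ends a₁ a₂ v W ∩ connEvent ends r o) =
      prob p (fibre ends a₁ a₂ x W ∩ connEvent ends v x ∩ connEvent ends r o) +
      (if x ∈ W then 0 else
        prob p (sideEvent EA (clusterEvent ends v (↑W : Set V) ∩ connEvent ends o x)) *
          prob p (avoidAll ends a₂ {a₁} ∩ connEvent ends x r)) := by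
  rw [← prob_inter_add_prob_inter_compl p (fibre ends a₁ a₂ v W ∩ connEvent ends r o)
    (connEvent ends v x)]
  have e1 : fibre ends a₁ a₂ v W ∩ connEvent ends r o ∩ connEvent ends v x =
      fibre ends a₁ a₂ x W ∩ connEvent ends v x ∩ connEvent ends r o := by
    rw [Set.inter_right_comm, fibre_v_inter_conn]
  have e2 : fibre ends a₁ a₂ v W ∩ connEvent ends r o ∩ (connEvent ends v x)ᶜ =
      fibre ends a₁ a₂ v W ∩ (connEvent ends v x)ᶜ ∩ connEvent ends r o := by
    rw [Set.inter_right_comm]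
  rw [e1, e2, fibre_v_inter_compl h hv]
  congr 1
  split_ifs with hxW
  · rw [Set.empty_inter]; exact prob_empty p
  · have e : sideEvent EA (clusterEvent ends v (↑W : Set V)) ∩ avoidAll ends a₂ {a₁} ∩ connEvent ends r o =
        sideEvent EA (clusterEvent ends v (↑W : Set V) ∩ connEvent ends o x) ∩
          sideEvent EB (avoidAll ends a₂ {a₁} ∩ connEvent ends x r) := by
      rw [connEvent_o_eq h ho hr, ← sideEvent_inter, ← sideEvent_inter, ← avoidAll_eq_sideEventB' h h1 h2,
        ← connEvent_eq_sideEventB' h (Finset.mem_insert_self x VB) hr]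
      ext ω; simp only [Set.mem_inter_iff]; tauto
    rw [e, prob_sideEvent_inter_eq_mul p h, ← sideEvent_inter EB, ← avoidAll_eq_sideEventB' h h1 h2,
      ← connEvent_eq_sideEventB' h (Finset.mem_insert_self x VB) hr]

omit [Fintype V] [LinearOrder R] [IsStrictOrderedRing R] in
/-- The `σ_o`-mass of `v` splits (`o` on the `A`-side). -/
lemma Ssig_o_v_eq (h : IsCut ends x ↑VA ↑VB EA EB) (ho : o ∈ VA) (hv : v ∈ VA)
    (h1 : a₁ ∈ insert x VB) (h2 : a₂ ∈ insert x VB) (W : Finset V) :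
    Ssig p ends a₁ a₂ v o W = SsigZ p ends a₁ a₂ x o (connEvent ends v x) W +
      (if x ∈ W then 0 else
        prob p (sideEvent EA (clusterEvent ends v (↑W : Set V) ∩ connEvent ends o x)) *
          (prob p (avoidAll ends a₂ {a₁} ∩ connEvent ends x a₁) -
            prob p (avoidAll ends a₂ {a₁} ∩ connEvent ends x a₂))) := by
  unfold Ssig SsigZ
  rw [prob_fibre_v_conn_o_eq h ho hv h1 h2 h1, prob_fibre_v_conn_o_eq h ho hv h1 h2 h2]
  split_ifs <;> ring

omit [Fintype V] [LinearOrder R] [IsStrictOrderedRing R] in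
/-- The `U_o`-mass of `v` splits (`o` on the `A`-side). -/
lemma Su_o_v_eq (h : IsCut ends x ↑VA ↑VB EA EB) (ho : o ∈ VA) (hv : v ∈ VA)
    (h1 : a₁ ∈ insert x VB) (h2 : a₂ ∈ insert x VB) (W : Finset V) :
    Su p ends a₁ a₂ v o W = SuZ p ends a₁ a₂ x o (connEvent ends v x) W +
      (if x ∈ W then 0 else
        prob p (sideEvent EA (clusterEvent ends v (↑W : Set V) ∩ connEvent ends o x)) *
          (prob p (avoidAll ends a₂ {a₁} ∩ connEvent ends x a₁) +
            prob p (avoidAll ends a₂ {a₁} ∩ connEvent ends x a₂))) := by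
  unfold Su SuZ
  rw [prob_fibre_v_conn_o_eq h ho hv h1 h2 h1, prob_fibre_v_conn_o_eq h ho hv h1 h2 h2]
  split_ifs <;> ring

omit [Fintype V] [Fintype E] [DecidableEq E] [Field R] [LinearOrder R] [IsStrictOrderedRing R]
  [DecidablePred (· ∈ EB)] in
/-- On a fibre of `x` containing `o`, `{r ↔ o}` is `{r ↔ x}`. -/
lemma fibre_x_inter_conn_o_of_mem (h : IsCut ends x ↑VA ↑VB EA EB) (ho : o ∈ VA) {r : V}
    (hr : r ∈ insert x VB) (a₁ a₂ : V) {W : Finset V} (hoW : o ∈ W) (Y : Set (Config E)) :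
    fibre ends a₁ a₂ x W ∩ Y ∩ connEvent ends r o = fibre ends a₁ a₂ x W ∩ Y ∩ connEvent ends r x := by
  ext ω
  simp only [fibre, Set.mem_inter_iff, mem_clusterEvent, mem_connEvent]
  constructor
  · rintro ⟨⟨⟨hQ, hc⟩, hY⟩, hro⟩
    refine ⟨⟨⟨hQ, hc⟩, hY⟩, ?_⟩
    have hox := conn_oA_of_conn h ho hr hro
    exact conn_trans hro (conn_mono (restrict_le EA ω) hox)
  · rintro ⟨⟨⟨hQ, hc⟩, hY⟩, hrx⟩
    refine ⟨⟨⟨hQ, hc⟩, hY⟩, ?_⟩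
    have hxo : Conn ends ω x o := by
      have : o ∈ cluster ends ω x := by rw [hc]; exact Finset.mem_coe.2 hoW
      exact this
    exact conn_trans hrx hxo

omit [Fintype V] [LinearOrder R] [IsStrictOrderedRing R] [DecidablePred (· ∈ EB)] in
/-- The `Z`-restricted `σ_o`-mass on the fibres of `x` (`o` on the `A`-side). -/
lemma SsigZ_o_eq (h : IsCut ends x ↑VA ↑VB EA EB) (ho : o ∈ VA) (h1 : a₁ ∈ insert x VB)
    (h2 : a₂ ∈ insert x VB) (Z : Set (Config E)) (W : Finset V) :
    SsigZ p ends a₁ a₂ x o Z W =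
      (if o ∈ W then 1 else 0) * (s3 a₁ a₂ W * mZ p ends a₁ a₂ x Z W) := by
  unfold SsigZ mZ
  by_cases hoW : o ∈ W
  · have k : ∀ u, fibre ends a₁ a₂ x W ∩ Z ∩ connEvent ends u x =
        if u ∈ W then fibre ends a₁ a₂ x W ∩ Z else ∅ := by
      intro u
      rw [Set.inter_assoc, Set.inter_comm Z, fibre_inter_conn_a3]
    rw [if_pos hoW, one_mul, fibre_x_inter_conn_o_of_mem h ho h1 a₁ a₂ hoW,
      fibre_x_inter_conn_o_of_mem h ho h2 a₁ a₂ hoW, k a₁, k a₂]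
    unfold s3
    by_cases hA1 : a₁ ∈ W <;> by_cases hA2 : a₂ ∈ W
    · rw [fibre_eq_empty_of_mem_mem ends a₁ a₂ x hA1 hA2]
      simp
    · simp [hA1, hA2]
    · simp [hA1, hA2]
    · simp [hA1, hA2]
  · rw [if_neg hoW, zero_mul]
    have e : ∀ r, r ∈ insert x VB → fibre ends a₁ a₂ x W ∩ Z ∩ connEvent ends r o = ∅ := by
      intro r hr
      rw [Set.inter_right_comm, fibre_x_inter_conn_o_eq_empty h ho hr a₁ a₂ hoW, Set.empty_inter]
    rw [e a₁ h1, e a₂ h2, prob_empty, sub_zero]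

omit [Fintype V] [LinearOrder R] [IsStrictOrderedRing R] [DecidablePred (· ∈ EB)] in
/-- The `Z`-restricted `U_o`-mass on the fibres of `x` (`o` on the `A`-side). -/
lemma SuZ_o_eq (h : IsCut ends x ↑VA ↑VB EA EB) (ho : o ∈ VA) (h1 : a₁ ∈ insert x VB)
    (h2 : a₂ ∈ insert x VB) (Z : Set (Config E)) (W : Finset V) :
    SuZ p ends a₁ a₂ x o Z W =
      (if o ∈ W then 1 else 0) * (s3 a₁ a₂ W ^ 2 * mZ p ends a₁ a₂ x Z W) := by
  unfold SuZ mZ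
  by_cases hoW : o ∈ W
  · have k : ∀ u, fibre ends a₁ a₂ x W ∩ Z ∩ connEvent ends u x =
        if u ∈ W then fibre ends a₁ a₂ x W ∩ Z else ∅ := by
      intro u
      rw [Set.inter_assoc, Set.inter_comm Z, fibre_inter_conn_a3]
    rw [if_pos hoW, one_mul, fibre_x_inter_conn_o_of_mem h ho h1 a₁ a₂ hoW,
      fibre_x_inter_conn_o_of_mem h ho h2 a₁ a₂ hoW, k a₁, k a₂]
    unfold s3
    by_cases hA1 : a₁ ∈ W <;> by_cases hA2 : a₂ ∈ W
    · rw [fibre_eq_empty_of_mem_mem ends a₁ a₂ x hA1 hA2]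
      simp
    · simp [hA1, hA2]
    · simp [hA1, hA2]
    · simp [hA1, hA2]
  · rw [if_neg hoW, zero_mul]
    have e : ∀ r, r ∈ insert x VB → fibre ends a₁ a₂ x W ∩ Z ∩ connEvent ends r o = ∅ := by
      intro r hr
      rw [Set.inter_right_comm, fibre_x_inter_conn_o_eq_empty h ho hr a₁ a₂ hoW, Set.empty_inter]
    rw [e a₁ h1, e a₂ h2, prob_empty, add_zero]

end OSideV

end A3Fibre

end CovForm

end Summit.Ventures.PercRepro2
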